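import Summits.CriticalPhenomena.PercolationContinuityZ3.Theorems.Transplant.SubgraphLocModCycleA
import Summits.CriticalPhenomena.PercolationContinuityZ3.Theorems.Transplant.CayleySkeletonKernel
import HarnessLib

/-!
# Cylinders of a Cayley-graph skeleton, I: power walks, the cylinder data, kernel words

builds on p205010 (kernel theorem, internal audit signed; external expert review pending) — nothing in this file uses p205010.
Lane `prim-bschramm`, seat `prim-bschramm-p4` gen 10 (PART C3, tier 2′ of `P4-GENERAL.md`).  Helper file
(`--supports stmt-CriticalPhenomena-4575 --as helper`).

Data `CayCyl.CylData Γ S`: an additive `φ : Γ → ℤ²` of sup-norm `≤ 1` on the generators, unit-step generators `s₀, s₁` (`φ s_i = e_i`), and the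
kernel generated by the generators of height `0` (NO reversing automorphism, NO finite-conjugacy element).  In the big cylinder
`V_L = {‖φ‖_∞ ≤ L}` of `Cay(Γ; S)` (`H = G.induce V_L`, `L = ℓ + 1`) we build, for every edge `{x, y}` of the small cylinder `‖φ‖_∞ ≤ ℓ`, a
`SubLoc.CycleKit`: `A` = the `s₀`-column of `x` DOWN to the floor `φ₀ = −L`, `B` = the `s₀`-column of `y` up to the ceiling `φ₀ = L` (reversed),
`M` = a path on the FRAME `‖φ‖_∞ = L` from the floor point to the ceiling point (along `s₁` to the corner, up the side by `s₀`, back along the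
ceiling by `s₁⁻¹`, then a word in the kernel generators; made simple by `Walk.bypass`) — all frame edges leave the small cylinder, so they are
enhancement edges.  This file: power walks (§1), the data, heights of powers and kernel words (§2).  The columns, the frame walk and the kit are
the sequel `CayleyCylinderKit`; the strict inequality and Φ2 are `CayleyCylinderStrict`.
-/

noncomputable section

namespace Summit.CriticalPhenomena.PercolationContinuityZ3.Theorems.Transplant

namespace CayCyl

open SimpleGraph Walk Literature.Probability.LatticeModels SubLoc
open Literature.Barriers.CriticalPhenomena (graphBall graphBall_mono mem_graphBall_self)
open scoped Classical

variable {Γ : Type} [Group Γ] {S : Finset Γ}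

/-! ## §1 Power walks in `Cay(Γ; S)` -/

section Pow

variable (S)

/-- Right multiplication by an element of `S ∪ S⁻¹` other than `1` is an edge of `Cay(Γ; S)`. [cite: BenjaminiSchramm1996, §2 (Cayley graphs)] -/
theorem adj_mul_of_mem {t : Γ} (ht : t ∈ S ∨ t⁻¹ ∈ S) (ht1 : t ≠ 1) (g : Γ) : (mulCayley (S : Set Γ)).Adj g (g * t) := by
  rw [mulCayley_adj]
  refine ⟨fun h => ht1 (mul_left_cancel (a := g) (by rw [mul_one]; exact h.symm)), ?_⟩
  rcases ht with ht | ht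
  · exact Or.inl (by rw [inv_mul_cancel_left]; exact Finset.mem_coe.2 ht)
  · exact Or.inr (by rw [mul_inv_rev, inv_mul_cancel_right]; exact Finset.mem_coe.2 ht)

/-- **The power walk** `g, g t, g t², …, g tⁿ`. [folklore] -/
def powWalk {t : Γ} (hadj : ∀ g : Γ, (mulCayley (S : Set Γ)).Adj g (g * t)) : ∀ (g : Γ) (n : ℕ), (mulCayley (S : Set Γ)).Walk g (g * t ^ n)
  | g, 0 => (Walk.nil : (mulCayley (S : Set Γ)).Walk g g).copy rfl (by rw [pow_zero, mul_one])
  | g, n + 1 => (Walk.cons (hadj g) (powWalk hadj (g * t) n)).copy rfl (by rw [pow_succ', mul_assoc])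

variable {S}

/-- Membership in the support of a power walk. [folklore] -/
theorem mem_support_powWalk {t : Γ} (hadj : ∀ g : Γ, (mulCayley (S : Set Γ)).Adj g (g * t)) {g : Γ} {n : ℕ} {w : Γ} :
    w ∈ (powWalk S hadj g n).support ↔ ∃ i, i ≤ n ∧ w = g * t ^ i := by
  induction n generalizing g with
  | zero =>
    simp only [powWalk, support_copy, support_nil, List.mem_singleton]
    constructor
    · rintro rfl; exact ⟨0, le_rfl, by rw [pow_zero, mul_one]⟩
    · rintro ⟨i, hi, rfl⟩; rw [Nat.le_zero.1 hi, pow_zero, mul_one]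
  | succ n ih =>
    rw [powWalk, support_copy, support_cons, List.mem_cons, ih]
    constructor
    · rintro (rfl | ⟨i, hi, rfl⟩)
      · exact ⟨0, Nat.zero_le _, by rw [pow_zero, mul_one]⟩
      · exact ⟨i + 1, Nat.succ_le_succ hi, by rw [pow_succ', mul_assoc]⟩
    · rintro ⟨i, hi, rfl⟩
      rcases i with _ | i
      · exact Or.inl (by rw [pow_zero, mul_one])
      · exact Or.inr ⟨i, Nat.succ_le_succ_iff.1 hi, by rw [pow_succ', mul_assoc]⟩

/-- The length of a power walk. [folklore] -/
theorem length_powWalk {t : Γ} (hadj : ∀ g : Γ, (mulCayley (S : Set Γ)).Adj g (g * t)) (g : Γ) (n : ℕ) :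
    (powWalk S hadj g n).length = n := by
  induction n generalizing g with
  | zero => simp [powWalk]
  | succ n ih => rw [powWalk, length_copy, length_cons, ih]

/-- A power walk along an element whose powers are distinct is a path. [folklore] -/
theorem isPath_powWalk {t : Γ} (hadj : ∀ g : Γ, (mulCayley (S : Set Γ)).Adj g (g * t)) (hinj : ∀ i j : ℕ, t ^ i = t ^ j → i = j)
    (g : Γ) (n : ℕ) : (powWalk S hadj g n).IsPath := by
  induction n generalizing g with
  | zero => simp [powWalk]
  | succ n ih =>
    rw [powWalk, isPath_copy, cons_isPath_iff]
    refine ⟨ih (g * t), fun hmem => ?_⟩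
    obtain ⟨i, -, hi⟩ := (mem_support_powWalk hadj).1 hmem
    rw [mul_assoc, ← pow_succ'] at hi
    have h0 : t ^ 0 = t ^ (i + 1) := by rw [pow_zero]; exact mul_left_cancel (a := g) (by rw [mul_one]; exact hi)
    exact absurd (hinj _ _ h0) (by omega)

end Pow

/-! ## §2 The data, heights of powers, kernel words -/

/-- **CYLINDER DATA on `Cay(Γ; S)`**: an additive `φ : Γ → ℤ²`, sup-norm `≤ 1` on `S`, unit-step generators `s₀, s₁ ∈ S`, and the kernel of `φ`
generated by the generators it contains.  (The skeleton part of a `CayleyNeg`, without any automorphism and without any finite-conjugacy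
element.) [cite: BenjaminiSchramm1996, §2 (Cayley graphs)] [cite: KozmaNitzan2024, §4 p. 16 (Lemma 8)] -/
structure CylData (Γ : Type) [Group Γ] (S : Finset Γ) where
  /-- the skeleton homomorphism -/
  φ : Γ → Site 2
  /-- additivity -/
  map_mul : ∀ g h : Γ, φ (g * h) = φ g + φ h
  /-- generators have sup-norm `≤ 1` -/
  lip : ∀ s ∈ S, ∀ i : Fin 2, |φ s i| ≤ 1
  /-- the unit step in direction `0` -/
  s₀ : Γ
  /-- it is a generator -/
  s₀_mem : s₀ ∈ S
  /-- its height -/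
  φ_s₀ : φ s₀ = Pi.single 0 1
  /-- the unit step in direction `1` -/
  s₁ : Γ
  /-- it is a generator -/
  s₁_mem : s₁ ∈ S
  /-- its height -/
  φ_s₁ : φ s₁ = Pi.single 1 1
  /-- the kernel is generated by the generators of height `0` -/
  ker_gen : ∀ g : Γ, φ g = 0 → g ∈ Subgroup.closure (↑(S.filter fun s => φ s = 0) : Set Γ)

namespace CylData

variable (D : CylData Γ S)

/-- `φ 1 = 0`. [folklore] -/
theorem φ_one : D.φ 1 = 0 := by
  have h := D.map_mul 1 1; rw [one_mul] at h; exact left_eq_add.1 h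

/-- `φ (g⁻¹) = −φ g`. [folklore] -/
theorem φ_inv (g : Γ) : D.φ g⁻¹ = -D.φ g := by
  have h := D.map_mul g⁻¹ g; rw [inv_mul_cancel, φ_one] at h; exact eq_neg_of_add_eq_zero_left h.symm

/-- Heights of integer powers. [folklore] -/
theorem φ_zpow (t : Γ) (z : ℤ) : D.φ (t ^ z) = z • D.φ t := by
  induction z using Int.induction_on with
  | zero => rw [zpow_zero, φ_one, zero_smul]
  | succ n ih => rw [zpow_add_one, D.map_mul, ih, add_smul, one_smul]
  | pred n ih => rw [zpow_sub_one, D.map_mul, ih, φ_inv, sub_smul, one_smul, sub_eq_add_neg]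

/-- Heights of natural powers. [folklore] -/
theorem φ_pow (t : Γ) (n : ℕ) : D.φ (t ^ n) = (n : ℤ) • D.φ t := by
  rw [← zpow_natCast, φ_zpow]

/-- `φ (g s₀^z) = φ g + z e₀`. [folklore] -/
theorem φ_mul_s₀_zpow (g : Γ) (z : ℤ) : D.φ (g * D.s₀ ^ z) = D.φ g + Pi.single 0 z := by
  rw [D.map_mul, φ_zpow, φ_s₀, ← Pi.single_smul', smul_eq_mul, mul_one]

/-- `φ (g s₁^z) = φ g + z e₁`. [folklore] -/
theorem φ_mul_s₁_zpow (g : Γ) (z : ℤ) : D.φ (g * D.s₁ ^ z) = D.φ g + Pi.single 1 z := by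
  rw [D.map_mul, φ_zpow, φ_s₁, ← Pi.single_smul', smul_eq_mul, mul_one]

/-- Powers of `s₀` are distinct. [folklore] -/
theorem s₀_pow_injective (i j : ℕ) (h : D.s₀ ^ i = D.s₀ ^ j) : i = j := by
  have h1 := congrArg (fun g => D.φ g 0) h
  simp only [φ_pow, φ_s₀, Pi.smul_apply, Pi.single_eq_same, smul_eq_mul, mul_one] at h1
  exact_mod_cast h1

/-- Powers of `s₁` are distinct. [folklore] -/
theorem s₁_pow_injective (i j : ℕ) (h : D.s₁ ^ i = D.s₁ ^ j) : i = j := by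
  have h1 := congrArg (fun g => D.φ g 1) h
  simp only [φ_pow, φ_s₁, Pi.smul_apply, Pi.single_eq_same, smul_eq_mul, mul_one] at h1
  exact_mod_cast h1

/-- `s₀ ≠ 1`, `s₁ ≠ 1` and their inverses. [folklore] -/
theorem s₀_ne_one : D.s₀ ≠ 1 := fun h => by have := congrFun D.φ_s₀ 0; rw [h, φ_one] at this; simp at this

/-- `s₁ ≠ 1`. [folklore] -/
theorem s₁_ne_one : D.s₁ ≠ 1 := fun h => by have := congrFun D.φ_s₁ 1; rw [h, φ_one] at this; simp at this

/-- Steps by `s₀^{±1}`, `s₁^{±1}` are edges. [folklore] -/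
theorem adj_s₀ (g : Γ) : (mulCayley (S : Set Γ)).Adj g (g * D.s₀) := adj_mul_of_mem S (Or.inl D.s₀_mem) D.s₀_ne_one g

/-- Steps by `s₀⁻¹` are edges. [folklore] -/
theorem adj_s₀_inv (g : Γ) : (mulCayley (S : Set Γ)).Adj g (g * D.s₀⁻¹) :=
  adj_mul_of_mem S (Or.inr (by rw [inv_inv]; exact D.s₀_mem)) (inv_ne_one.2 D.s₀_ne_one) g

/-- Steps by `s₁` are edges. [folklore] -/
theorem adj_s₁ (g : Γ) : (mulCayley (S : Set Γ)).Adj g (g * D.s₁) := adj_mul_of_mem S (Or.inl D.s₁_mem) D.s₁_ne_one g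

/-- Steps by `s₁⁻¹` are edges. [folklore] -/
theorem adj_s₁_inv (g : Γ) : (mulCayley (S : Set Γ)).Adj g (g * D.s₁⁻¹) :=
  adj_mul_of_mem S (Or.inr (by rw [inv_inv]; exact D.s₁_mem)) (inv_ne_one.2 D.s₁_ne_one) g

/-- The sup-norm of `φ` changes by at most one along an edge. [folklore] -/
theorem lip_adj {u v : Γ} (h : (mulCayley (S : Set Γ)).Adj u v) (i : Fin 2) : |D.φ v i - D.φ u i| ≤ 1 := by
  rw [mulCayley_adj] at h
  obtain ⟨-, h | h⟩ := h
  · have h1 := D.lip _ (Finset.mem_coe.1 h) i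
    rwa [D.map_mul, φ_inv, Pi.add_apply, Pi.neg_apply, neg_add_eq_sub] at h1
  · have h1 := D.lip _ (Finset.mem_coe.1 h) i
    rwa [D.map_mul, φ_inv, Pi.add_apply, Pi.neg_apply, neg_add_eq_sub, abs_sub_comm] at h1

/-- **Kernel words**: an element of `ker φ` is joined to `1` inside the level set `φ = 0` of `Cay(Γ; S)`. [cite: BenjaminiSchramm1996, §2 (Cayley graphs)] -/
theorem exists_kerWalk (k : Γ) (hk : D.φ k = 0) :
    ∃ w : (mulCayley (S : Set Γ)).Walk 1 k, ∀ v ∈ w.support, D.φ v = 0 := by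
  have hA : ∀ t ∈ S.filter (fun s => D.φ s = 0), ∀ h : Γ, h ∈ {g | D.φ g = 0} ↔ h * t ∈ {g | D.φ g = 0} := by
    intro t ht h
    rw [Finset.mem_filter] at ht
    show D.φ h = 0 ↔ D.φ (h * t) = 0
    rw [D.map_mul, ht.2, add_zero]
  have h1 : (1 : Γ) ∈ {g | D.φ g = 0} := D.φ_one
  obtain ⟨w⟩ := (CayleyKernel.reachable_mul_of_mem_closure S (Finset.filter_subset _ S) hA (D.ker_gen k hk)).2 1 h1
    (by rw [one_mul]; exact hk)
  refine ⟨(w.map (Embedding.induce _).toHom).copy rfl (one_mul k), fun v hv => ?_⟩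
  rw [support_copy, Walk.support_map, List.mem_map] at hv
  obtain ⟨z, -, rfl⟩ := hv
  exact z.2

/-- A chosen kernel word. [folklore] -/
def kerWalk (k : Γ) (hk : D.φ k = 0) : (mulCayley (S : Set Γ)).Walk 1 k := Classical.choose (D.exists_kerWalk k hk)

/-- The chosen kernel word stays in the level set `φ = 0`. [folklore] -/
theorem kerWalk_level (k : Γ) (hk : D.φ k = 0) : ∀ v ∈ (D.kerWalk k hk).support, D.φ v = 0 :=
  Classical.choose_spec (D.exists_kerWalk k hk)

/-- The length of the chosen kernel word (`0` off the kernel). [folklore] -/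
def kerWalkLen (k : Γ) : ℕ := if hk : D.φ k = 0 then (D.kerWalk k hk).length else 0

/-- `kerWalkLen` is the length of `kerWalk`. [folklore] -/
theorem length_kerWalk (k : Γ) (hk : D.φ k = 0) : (D.kerWalk k hk).length = D.kerWalkLen k := by
  rw [kerWalkLen, dif_pos hk]

end CylData

/-! ## §3 Left translates of walks -/

/-- **The left translate `c · w`** of a walk of `Cay(Γ; S)` (left multiplications are automorphisms). [cite: BenjaminiSchramm1996, §2 (Cayley graphs)] -/
def lmul (S : Finset Γ) (c : Γ) : ∀ {u v : Γ}, (mulCayley (S : Set Γ)).Walk u v → (mulCayley (S : Set Γ)).Walk (c * u) (c * v)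
  | _, _, Walk.nil => Walk.nil
  | _, _, Walk.cons h p => Walk.cons (mulCayley_adj_mul_iff_right.2 h) (lmul S c p)

/-- The vertices of a left translate. [folklore] -/
theorem support_lmul {c u v : Γ} (w : (mulCayley (S : Set Γ)).Walk u v) : (lmul S c w).support = w.support.map (c * ·) := by
  induction w with
  | nil => rfl
  | cons h p ih => rw [lmul, support_cons, support_cons, ih, List.map_cons]

/-- Membership in the support of a left translate. [folklore] -/
theorem mem_support_lmul {c u v z : Γ} {w : (mulCayley (S : Set Γ)).Walk u v} :
    z ∈ (lmul S c w).support ↔ ∃ v' ∈ w.support, z = c * v' := by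
  rw [support_lmul, List.mem_map]
  constructor
  · rintro ⟨v', hv', rfl⟩; exact ⟨v', hv', rfl⟩
  · rintro ⟨v', hv', rfl⟩; exact ⟨v', hv', rfl⟩

/-- The length of a left translate. [folklore] -/
@[simp] theorem length_lmul {c u v : Γ} (w : (mulCayley (S : Set Γ)).Walk u v) : (lmul S c w).length = w.length := by
  induction w with
  | nil => rfl
  | cons h p ih => rw [lmul, length_cons, length_cons, ih]

end CayCyl

end Summit.CriticalPhenomena.PercolationContinuityZ3.Theorems.Transplant

end
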